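import Mathlib
import Literature.Analysis.Fourier.HilbertTransformLineTrunc
import Literature.Analysis.Fourier.BeurlingMalliavinMultiplier
import Literature.NumberTheory.ConnesConsani2021.SineIntegralAsymptotics
import HarnessLib

/-!
# The Fourier multiplier of the truncated Hilbert transform on the line

`Literature/Analysis/Fourier`. For `f ∈ L¹(ℝ)` (real-valued) and a truncation window `0 < ε ≤ R`, the
doubly truncated symmetric Hilbert transform `H_{ε,R} f = π⁻¹ ∫_{ε<t<R} (f(·−t) − f(·+t))/t dt`
(`hilbertTransformTrunc`, file `HilbertTransformLineTrunc.lean`) has Fourier transform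

  `𝓕(H_{ε,R} f)(k) = m_{ε,R}(k) · 𝓕 f(k)`,   `m_{ε,R}(k) = π⁻¹ ∫_{ε<t<R} (e^{−2πitk} − e^{2πitk}) dt/t = −(2i/π)·(Si(2πkR) − Si(2πkε))`

(`fourier_hilbertTransformTrunc`; Fubini and the translation rule for `𝓕`), where `Si(x) = ∫₀ˣ sin t/t dt` is the
sine integral `Literature.NumberTheory.ConnesConsani2021.sinIntegral`. Consequently the multipliers are uniformly
bounded, `|m_{ε,R}(k)| ≤ 20/π < 7` (`norm_hilbertTruncMultiplier_le`, from `|Si| ≤ 5`), and along the exhausting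
windows `(1/(n+1), n+1)` they converge to `−i·sgn k` (`tendsto_hilbertTruncMultiplier`, from `Si(±∞) = ±π/2`).
This is the computation [cite: Grafakos2014, eqs. (5.1.8)–(5.1.12)] (`Ŵ₀(ξ) = −i sgn ξ`, whose brackets are
«uniformly bounded by 8 and converge to π … whenever x ≠ 0»), written for the operator acting on an `L¹` function
rather than for the distribution `W₀`; it is the input of the `L²` isometry `‖Hf‖₂ = ‖f‖₂`
[cite: Grafakos2014, eq. (5.1.14)] (`HilbertTransformLineL2.lean`). No definitions. WHAT THIS IS NOT (cell ns-blowup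
bookkeeping): not Navier–Stokes — classical harmonic analysis for the SHEET-ℝ certificate frame.
-/

namespace Literature.Analysis.Fourier

open _root_.MeasureTheory Set Filter _root_.Complex
open Literature.NumberTheory.ConnesConsani2021
open scoped Real Topology FourierTransform

/-! ### The exponential bracket `e^{−iθ} − e^{iθ} = −2i sin θ` -/

/-- `𝐞(−s) − 𝐞(s) = −2i·sin(2πs)` for the standard additive character `𝐞(s) = e^{2πis}`. [folklore] -/
private theorem fourierChar_neg_sub (s : ℝ) :
    ((𝐞 (-s) : Circle) : ℂ) - ((𝐞 s : Circle) : ℂ) = -2 * I * ((Real.sin (2 * π * s) : ℝ) : ℂ) := by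
  rw [Real.fourierChar_apply, Real.fourierChar_apply, Complex.ofReal_sin]
  have h1 : ((2 * π * -s : ℝ) : ℂ) * I = (-((2 * π * s : ℝ) : ℂ)) * I := by push_cast; ring
  rw [h1, Complex.exp_mul_I, Complex.exp_mul_I, Complex.cos_neg, Complex.sin_neg]
  ring

/-! ### The `t`-integral of the bracket is a sine integral -/

/-- `∫_{(ε,R)} sin(ct)/t dt = Si(cR) − Si(cε)` for `0 < ε ≤ R` (any real `c`; substitution `u = ct`). [folklore] -/
private theorem setIntegral_sin_mul_div (c : ℝ) {ε R : ℝ} (hε : 0 < ε) (hεR : ε ≤ R) :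
    ∫ t in Ioo ε R, Real.sin (c * t) / t = sinIntegral (c * R) - sinIntegral (c * ε) := by
  rw [← integral_Ioc_eq_integral_Ioo, ← intervalIntegral.integral_of_le hεR]
  rcases eq_or_ne c 0 with rfl | hc
  · simp [sinIntegral_zero]
  -- `sin(ct)/t = c · sinc(ct)` on `[ε, R]`
  have hcongr : ∀ t ∈ uIcc ε R, Real.sin (c * t) / t = c * Real.sinc (c * t) := by
    intro t ht
    rw [uIcc_of_le hεR] at ht
    have ht0 : t ≠ 0 := (hε.trans_le ht.1).ne'
    rw [Real.sinc_of_ne_zero (mul_ne_zero hc ht0)]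
    field_simp
  rw [intervalIntegral.integral_congr hcongr, intervalIntegral.integral_const_mul,
    intervalIntegral.integral_comp_mul_left (fun u => Real.sinc u) hc, smul_eq_mul, ← mul_assoc,
    mul_inv_cancel₀ hc, one_mul, sinIntegral_eq_integral_sinc, sinIntegral_eq_integral_sinc,
    intervalIntegral.integral_interval_sub_left]
  · exact Real.continuous_sinc.intervalIntegrable _ _
  · exact Real.continuous_sinc.intervalIntegrable _ _

/-- The bracket integral in closed form: `∫_{(ε,R)} (𝐞(−tk) − 𝐞(tk))/t dt = −2i (Si(2πkR) − Si(2πkε))`, `0 < ε ≤ R`.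
[folklore] -/
private theorem setIntegral_bracket_div {ε R : ℝ} (hε : 0 < ε) (hεR : ε ≤ R) (k : ℝ) :
    ∫ t in Ioo ε R, (((𝐞 (-(t * k)) : Circle) : ℂ) - ((𝐞 (t * k) : Circle) : ℂ)) / (t : ℂ) =
      -2 * I * ((sinIntegral (2 * π * k * R) - sinIntegral (2 * π * k * ε) : ℝ) : ℂ) := by
  have hpt : ∀ t : ℝ, (((𝐞 (-(t * k)) : Circle) : ℂ) - ((𝐞 (t * k) : Circle) : ℂ)) / (t : ℂ) =
      -2 * I * ((Real.sin (2 * π * k * t) / t : ℝ) : ℂ) := by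
    intro t
    rw [fourierChar_neg_sub, show 2 * π * (t * k) = 2 * π * k * t by ring]
    push_cast
    ring
  simp_rw [hpt]
  rw [integral_const_mul, integral_complex_ofReal, setIntegral_sin_mul_div (2 * π * k) hε hεR]

/-! ### The multiplier identity -/

/-- **Fourier transform of the truncated Hilbert transform (integral form of the multiplier).** For real
`f ∈ L¹(ℝ)` and `0 < ε`: `𝓕(H_{ε,R} f)(k) = (π⁻¹ ∫_{(ε,R)} (𝐞(−tk) − 𝐞(tk))/t dt) · 𝓕 f(k)` (Fubini over
`ℝ × (ε,R)` and the translation rule `𝓕(f(· + b))(k) = 𝐞(bk)𝓕f(k)`).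
[cite: Grafakos2014, eq. (5.1.8) (the bracket `π⁻¹∫_{ε≤|ξ|≤1/ε} e^{−2πixξ} dξ/ξ`)] -/
theorem fourier_hilbertTransformTrunc_eq_integral {f : ℝ → ℝ} (hf : Integrable f) {ε R : ℝ} (hε : 0 < ε)
    (k : ℝ) :
    𝓕 (fun x => (hilbertTransformTrunc ε R f x : ℂ)) k =
      ((π⁻¹ : ℝ) : ℂ) * (∫ t in Ioo ε R, (((𝐞 (-(t * k)) : Circle) : ℂ) - ((𝐞 (t * k) : Circle) : ℂ)) / (t : ℂ))
        * 𝓕 (fun x => (f x : ℂ)) k := by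
  -- the character `x ↦ 𝐞(−xk)` as a complex function: continuous, unimodular
  have hχc : Continuous fun x : ℝ => ((𝐞 (-(x * k)) : Circle) : ℂ) :=
    continuous_subtype_val.comp (Real.continuous_fourierChar.comp (by fun_prop))
  have hχn : ∀ x : ℝ, ‖((𝐞 (-(x * k)) : Circle) : ℂ)‖ ≤ 1 := fun x => (Circle.norm_coe _).le
  -- the product integrand `G(x,t) = 𝐞(−xk) · (f(x−t) − f(x+t))/t` is integrable on `ℝ × (ε,R)`
  have hFint : Integrable (fun p : ℝ × ℝ => (((f (p.1 - p.2) - f (p.1 + p.2)) / p.2 : ℝ) : ℂ))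
      ((volume : Measure ℝ).prod (volume.restrict (Ioo ε R))) :=
    (integrable_prod_symmIntegrand hf hε (R := R)).ofReal
  have hGint : Integrable (fun p : ℝ × ℝ =>
      ((𝐞 (-(p.1 * k)) : Circle) : ℂ) * (((f (p.1 - p.2) - f (p.1 + p.2)) / p.2 : ℝ) : ℂ))
      ((volume : Measure ℝ).prod (volume.restrict (Ioo ε R))) :=
    hFint.bdd_mul (hχc.comp continuous_fst).aestronglyMeasurable (ae_of_all _ fun p => hχn p.1)
  -- unfold `𝓕` on the left and move the character inside the `t`-integral
  rw [Real.fourier_real_eq]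
  have hinner : ∀ x : ℝ, (𝐞 (-(x * k)) : Circle) • ((hilbertTransformTrunc ε R f x : ℝ) : ℂ) =
      ((π⁻¹ : ℝ) : ℂ) * ∫ t in Ioo ε R,
        ((𝐞 (-(x * k)) : Circle) : ℂ) * (((f (x - t) - f (x + t)) / t : ℝ) : ℂ) := by
    intro x
    rw [Circle.smul_def, smul_eq_mul, hilbertTransformTrunc, Complex.ofReal_mul, ← integral_complex_ofReal,
      mul_left_comm, ← integral_const_mul]
  have hL : (∫ v : ℝ, (𝐞 (-(v * k)) : Circle) • ((hilbertTransformTrunc ε R f v : ℝ) : ℂ)) =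
      ∫ x : ℝ, ((π⁻¹ : ℝ) : ℂ) * ∫ t in Ioo ε R,
        ((𝐞 (-(x * k)) : Circle) : ℂ) * (((f (x - t) - f (x + t)) / t : ℝ) : ℂ) :=
    integral_congr_ae (ae_of_all _ hinner)
  rw [hL, integral_const_mul, integral_integral_swap hGint]
  -- the inner `x`-integral, by the translation rule
  have e1 : ∀ t : ℝ, (∫ x : ℝ, ((𝐞 (-(x * k)) : Circle) : ℂ) * ((f (x - t) : ℝ) : ℂ)) =
      ((𝐞 (-(t * k)) : Circle) : ℂ) * 𝓕 (fun x => (f x : ℂ)) k := by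
    intro t
    have h := fourier_comp_add_right_apply (fun x => ((f x : ℝ) : ℂ)) (-t) k
    rw [Real.fourier_real_eq, neg_mul] at h
    simpa only [Circle.smul_def, smul_eq_mul, ← sub_eq_add_neg] using h
  have e2 : ∀ t : ℝ, (∫ x : ℝ, ((𝐞 (-(x * k)) : Circle) : ℂ) * ((f (x + t) : ℝ) : ℂ)) =
      ((𝐞 (t * k) : Circle) : ℂ) * 𝓕 (fun x => (f x : ℂ)) k := by
    intro t
    have h := fourier_comp_add_right_apply (fun x => ((f x : ℝ) : ℂ)) t k
    rw [Real.fourier_real_eq] at h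
    simpa only [Circle.smul_def, smul_eq_mul] using h
  have hx : ∀ t : ℝ, (∫ x : ℝ, ((𝐞 (-(x * k)) : Circle) : ℂ) * (((f (x - t) - f (x + t)) / t : ℝ) : ℂ)) =
      ((((𝐞 (-(t * k)) : Circle) : ℂ) - ((𝐞 (t * k) : Circle) : ℂ)) / (t : ℂ)) *
        𝓕 (fun x => (f x : ℂ)) k := by
    intro t
    have hsplit : (fun x : ℝ => ((𝐞 (-(x * k)) : Circle) : ℂ) * (((f (x - t) - f (x + t)) / t : ℝ) : ℂ)) =
        fun x => ((𝐞 (-(x * k)) : Circle) : ℂ) * ((f (x - t) : ℝ) : ℂ) * (t : ℂ)⁻¹ -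
          ((𝐞 (-(x * k)) : Circle) : ℂ) * ((f (x + t) : ℝ) : ℂ) * (t : ℂ)⁻¹ := by
      funext x; push_cast; ring
    have i1 : Integrable (fun x : ℝ => ((𝐞 (-(x * k)) : Circle) : ℂ) * ((f (x - t) : ℝ) : ℂ) * (t : ℂ)⁻¹) :=
      (((hf.comp_sub_right t).ofReal).bdd_mul hχc.aestronglyMeasurable (ae_of_all _ hχn)).mul_const _
    have i2 : Integrable (fun x : ℝ => ((𝐞 (-(x * k)) : Circle) : ℂ) * ((f (x + t) : ℝ) : ℂ) * (t : ℂ)⁻¹) :=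
      (((hf.comp_add_right t).ofReal).bdd_mul hχc.aestronglyMeasurable (ae_of_all _ hχn)).mul_const _
    rw [hsplit, integral_sub i1 i2, integral_mul_const, integral_mul_const, e1, e2]
    ring
  simp_rw [hx]
  rw [integral_mul_const, mul_assoc]

/-- **Fourier multiplier of the truncated Hilbert transform, closed form.** For real `f ∈ L¹(ℝ)` and
`0 < ε ≤ R`: `𝓕(H_{ε,R} f)(k) = −(2/π)(Si(2πkR) − Si(2πkε))·i · 𝓕f(k)` — the truncated version of
`(Hf)^ = −i sgn(ξ) f̂`. [cite: Grafakos2014, eqs. (5.1.8)–(5.1.13)] -/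
theorem fourier_hilbertTransformTrunc {f : ℝ → ℝ} (hf : Integrable f) {ε R : ℝ} (hε : 0 < ε) (hεR : ε ≤ R)
    (k : ℝ) :
    𝓕 (fun x => (hilbertTransformTrunc ε R f x : ℂ)) k =
      ((-(2 / π * (sinIntegral (2 * π * k * R) - sinIntegral (2 * π * k * ε))) : ℝ) : ℂ) * I
        * 𝓕 (fun x => (f x : ℂ)) k := by
  rw [fourier_hilbertTransformTrunc_eq_integral hf hε, setIntegral_bracket_div hε hεR]
  push_cast
  ring

/-! ### Uniform bound and limit of the multipliers -/

/-- **Uniform bound of the multipliers**: `‖−(2/π)(Si(b) − Si(a))·i‖ ≤ 20/π ≤ 7` (from `|Si| ≤ 5`).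
[cite: Grafakos2014, text after eq. (5.1.10) («uniformly bounded by 8»)] -/
theorem norm_hilbertTruncMultiplier_le (a b : ℝ) :
    ‖((-(2 / π * (sinIntegral b - sinIntegral a)) : ℝ) : ℂ) * I‖ ≤ 7 := by
  rw [norm_mul, Complex.norm_I, mul_one, Complex.norm_real, Real.norm_eq_abs, abs_neg, abs_mul,
    abs_of_pos (by positivity : (0 : ℝ) < 2 / π)]
  have h1 := abs_sinIntegral_le_five b
  have h2 := abs_sinIntegral_le_five a
  have h3 : |sinIntegral b - sinIntegral a| ≤ 10 := by
    have := abs_sub (sinIntegral b) (sinIntegral a); linarith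
  have hπ : 3 < π := Real.pi_gt_three
  calc 2 / π * |sinIntegral b - sinIntegral a| ≤ 2 / π * 10 := by gcongr
    _ = 20 / π := by ring
    _ ≤ 7 := by rw [div_le_iff₀ (by positivity)]; linarith

/-- **Limit of the multipliers along the exhausting windows**: for every `k`,
`−(2/π)(Si(2πk(n+1)) − Si(2πk/(n+1))) → −sgn k` as `n → ∞` (`Si(±∞) = ±π/2`, `Si(0) = 0`, `Si` continuous),
i.e. the multipliers converge to `−i·sgn k`. [cite: Grafakos2014, eqs. (5.1.11)–(5.1.12) («converge to π … whenever x ≠ 0»)] -/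
theorem tendsto_hilbertTruncMultiplier (k : ℝ) :
    Tendsto (fun n : ℕ => -(2 / π * (sinIntegral (2 * π * k * ((n : ℝ) + 1)) -
      sinIntegral (2 * π * k * (1 / ((n : ℝ) + 1)))))) atTop (𝓝 (-Real.sign k)) := by
  have hn : Tendsto (fun n : ℕ => (n : ℝ) + 1) atTop atTop :=
    tendsto_natCast_atTop_atTop.atTop_add tendsto_const_nhds
  have hinv : Tendsto (fun n : ℕ => 1 / ((n : ℝ) + 1)) atTop (𝓝 0) := tendsto_one_div_add_atTop_nhds_zero_nat
  -- the small-argument term tends to `Si 0 = 0`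
  have hsmall : Tendsto (fun n : ℕ => sinIntegral (2 * π * k * (1 / ((n : ℝ) + 1)))) atTop (𝓝 0) := by
    have h0 : Tendsto (fun n : ℕ => 2 * π * k * (1 / ((n : ℝ) + 1))) atTop (𝓝 0) := by
      simpa using hinv.const_mul (2 * π * k)
    have h1 := (continuous_sinIntegral.tendsto 0).comp h0
    rw [sinIntegral_zero] at h1
    exact h1
  rcases lt_trichotomy k 0 with hk | rfl | hk
  · -- `k < 0`: the large argument tends to `−∞`
    have hlarge : Tendsto (fun n : ℕ => sinIntegral (2 * π * k * ((n : ℝ) + 1))) atTop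
        (𝓝 (-(π / 2))) := by
      refine tendsto_sinIntegral_atBot.comp ?_
      have hc : 2 * π * k < 0 := by nlinarith [Real.pi_pos]
      exact hn.const_mul_atTop_of_neg hc
    rw [Real.sign_of_neg hk, neg_neg]
    have h := ((hlarge.sub hsmall).const_mul (2 / π)).neg
    have h2 : -(2 / π * (-(π / 2) - 0)) = 1 := by field_simp; ring
    rw [h2] at h
    exact h
  · simp [Real.sign_zero, sinIntegral_zero]
  · have hlarge : Tendsto (fun n : ℕ => sinIntegral (2 * π * k * ((n : ℝ) + 1))) atTop (𝓝 (π / 2)) := by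
      refine tendsto_sinIntegral_atTop.comp ?_
      have hc : 0 < 2 * π * k := by positivity
      exact hn.const_mul_atTop hc
    rw [Real.sign_of_pos hk]
    have h := ((hlarge.sub hsmall).const_mul (2 / π)).neg
    have h2 : -(2 / π * (π / 2 - 0)) = -1 := by field_simp; ring
    rw [h2] at h
    exact h

end Literature.Analysis.Fourier
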